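import Mathlib
import Summits.Ventures.PercRepro2.TwoHullMasterPathPendant

/-!
# The cube cover of a path with a pendant graph, II: the blocks and the cover (blind cell
PercRepro2, night-4 g40, 2026-08-29; proofs/NIGHT4-G40.md §14)

Every block of the decorated path (TwoHullMasterPathPendant.lean) is a monotone cube block
(**`cubeBlock_pend`**: before the key the pendant never meets the hull of `h` and the block mirrors
`h`; at the key it is complemented with the interface bit and the block mirrors both; after the key
it never meets the hull of `l` and the block mirrors `l`), and the blocks partition `U`:
**`cubeCover_path_pendant`** — the cube-cover conjecture on a path with an arbitrary graph at one
of its vertices other than `h`.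
-/

namespace Summit.Ventures.PercRepro2

namespace Blocks

open Hull LocRows Path2 Glue Glue2

open scoped Classical

variable {V : Type*} {k : ℕ} {p : Fin (k + 3) → V} {E₂ : Type*} {ends₂ : E₂ → Sym2 V}
  {V₁ V₂ : Set V}

/-- **Every block of the decorated path is a monotone cube block.** -/
theorem cubeBlock_pend (hp : Function.Injective p) (j : Fin (k + 3))
    (hg : IsGluing (pathEnds p) ends₂ (p j) V₁ V₂) (hl : p 0 ∈ V₁) (hh : p (Fin.last (k + 2)) ∈ V₁)
    (hjl : j ≠ Fin.last (k + 2)) (b : (Fin k ⊕ Unit) × Config E₂) :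
    CubeBlock (Glue.glue (pathEnds p) ends₂) (p 0) (p (Fin.last (k + 2))) (pendPt j b) := by
  have hpath : CubeBlock (pathEnds p) (p 0) (p (Fin.last (k + 2))) (pathPt b.1) := by
    rcases b with ⟨b₁, c⟩
    cases b₁ with
    | inl i => exact cubeBlock_keyWord hp i
    | inr u => exact cubeBlock_sentWord hp
  have hmem := pendPt_mem hp j hg hl hh hjl b
  have hinj : Function.Injective (pendPt j b) := by
    intro ε ε' heq
    have := congrArg (fun ζ => ζ ∘ Sum.inl) heq
    simp only [pendPt_inl] at this
    exact hpath.inj this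
  -- the position of the pendant relative to the key vertex of the block
  have hjv : j.val ≤ k + 1 := by
    have := j.isLt
    have hne : j.val ≠ k + 2 := fun h => hjl (Fin.ext h)
    omega
  -- the three kinds of blocks
  rcases b with ⟨b₁, c⟩
  -- key vertex position `kv` and the membership facts
  obtain ⟨kv, hkv, hbefore, hafter, hmerged⟩ :
      ∃ kv : ℕ, (mergedAt j b₁ ↔ j.val = kv) ∧
        (j.val < kv → ∀ ε : pathι b₁ → Bool, ∀ bb, ¬ Suf (pathPt b₁ ε) bb j) ∧
        (kv < j.val → ∀ ε : pathι b₁ → Bool, ∀ bb, ¬ Pre (pathPt b₁ ε) bb j) ∧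
        (j.val = kv → ∀ ε : pathι b₁ → Bool, ∀ bb,
          (Pre (pathPt b₁ ε) bb j → sbit b₁ ε = bb) ∧ (Suf (pathPt b₁ ε) bb j → (!sbit b₁ ε) = bb)) := by
    cases b₁ with
    | inl i =>
      refine ⟨i.val + 1, Iff.rfl, ?_, ?_, ?_⟩
      · intro hlt ε bb
        exact not_suf_keyWord ε bb (by omega)
      · intro hlt ε bb
        exact not_pre_keyWord ε bb (by omega)
      · intro hjk ε bb
        exact ⟨fun hP => pre_keyWord_succ hjk hP, fun hS => suf_keyWord_succ hjk hS⟩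
    | inr u =>
      refine ⟨k + 1, Iff.rfl, ?_, ?_, ?_⟩
      · intro hlt ε bb
        exact not_suf_sentWord ε bb (by omega)
      · intro hlt ε bb
        omega
      · intro hjk ε bb
        exact ⟨fun hP => pre_sentWord_succ hjk hP, fun hS => suf_sentWord_succ hjk hS⟩
  rcases Nat.lt_trichotomy j.val kv with hlt | heq | hgt
  · -- BEFORE the key: the pendant never meets the hull of `h`; the block mirrors `h`
    have hnm : ¬ mergedAt j b₁ := fun hm => by have := hkv.1 hm; omega
    have hPh : ∀ ε, hullPair (Glue.glue (pathEnds p) ends₂) (pendPt j (b₁, c) ε)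
        (p (Fin.last (k + 2))) = hullPair (pathEnds p) (pathPt b₁ ε) (p (Fin.last (k + 2))) := by
      intro ε
      rw [hullPair_pendPt_h j hg hh]
      refine pendPair_eq_of_notMem ?_ ?_
      · rw [mem_hullPair_last_fst hp]; exact hbefore hlt ε true
      · rw [mem_hullPair_last_snd hp]; exact hbefore hlt ε false
    have hPl : ∀ ε, hullPair (Glue.glue (pathEnds p) ends₂) (pendPt j (b₁, c) ε) (p 0) =
        pendPair (hullPair (pathEnds p) (pathPt b₁ ε) (p 0)) (p j) (hullPair ends₂ c (p j)) := by
      intro ε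
      rw [hullPair_pendPt_l j hg hl]
      simp [hnm]
    refine ⟨hinj, hmem, ?_, ?_, Or.inr ?_⟩
    · intro ε ε' hle
      rw [hPl, hPl]
      exact pendPair_mono_left (hpath.l_mono hle)
    · intro ε ε' hle
      rw [hPh, hPh]
      exact hpath.h_anti hle
    · intro ε
      rw [hPh, hPh, pathPt_cubeNot, hullPair_blue]
  · -- AT the key: the pendant is complemented with the interface bit; the block mirrors both
    have hm : mergedAt j b₁ := hkv.2 heq
    have hfacts := hmerged heq
    have hpend : ∀ ε, pendPt j (b₁, c) ε ∘ Sum.inr =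
        if sbit b₁ ε = true then blue c else c := by
      intro ε
      rw [pendPt_inr]
      simp [hm]
    have hPl : ∀ ε, hullPair (Glue.glue (pathEnds p) ends₂) (pendPt j (b₁, c) ε) (p 0) =
        pendPair (hullPair (pathEnds p) (pathPt b₁ ε) (p 0)) (p j)
          (if sbit b₁ ε = true then (hullPair ends₂ c (p j)).swap else hullPair ends₂ c (p j)) := by
      intro ε
      rw [hullPair_glue_pend hg hl, pendPt_inl, hpend]
      split_ifs <;> simp [hullPair_blue]
    have hPh : ∀ ε, hullPair (Glue.glue (pathEnds p) ends₂) (pendPt j (b₁, c) ε)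
        (p (Fin.last (k + 2))) =
        pendPair (hullPair (pathEnds p) (pathPt b₁ ε) (p (Fin.last (k + 2)))) (p j)
          (if sbit b₁ ε = true then (hullPair ends₂ c (p j)).swap else hullPair ends₂ c (p j)) := by
      intro ε
      rw [hullPair_glue_pend hg hh, pendPt_inl, hpend]
      split_ifs <;> simp [hullPair_blue]
    have hsle : ∀ {ε ε' : pathι b₁ → Bool}, ε ≤ ε' → sbit b₁ ε ≤ sbit b₁ ε' := by
      intro ε ε' hle
      cases b₁ with
      | inl i => exact hle (Sum.inr false)
      | inr u => exact hle ()
    refine ⟨hinj, hmem, ?_, ?_, Or.inl ?_⟩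
    · intro ε ε' hle
      rw [hPl, hPl]
      have hs := hsle hle
      rcases Bool.eq_false_or_eq_true (sbit b₁ ε) with h1 | h1 <;>
        rcases Bool.eq_false_or_eq_true (sbit b₁ ε') with h2 | h2
      · rw [h1, h2]; exact pendPair_mono_left (hpath.l_mono hle)
      · rw [h1, h2] at hs; exact absurd (Bool.le_iff_imp.1 hs rfl) (by decide)
      · rw [h1, h2]; simp only [Bool.false_eq_true, if_false, if_true]
        refine pendPair_le_swap (hpath.l_mono hle) ?_ ?_
        · rw [mem_hullPair_zero_fst hp]
          intro hP
          have := (hfacts ε true).1 hP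
          rw [h1] at this; exact absurd this (by decide)
        · rw [mem_hullPair_zero_snd hp]
          intro hP
          have := (hfacts ε' false).1 hP
          rw [h2] at this; exact absurd this (by decide)
      · rw [h1, h2]; simp only [Bool.false_eq_true, if_false]
        exact pendPair_mono_left (hpath.l_mono hle)
    · intro ε ε' hle
      rw [hPh, hPh]
      have hs := hsle hle
      rcases Bool.eq_false_or_eq_true (sbit b₁ ε) with h1 | h1 <;>
        rcases Bool.eq_false_or_eq_true (sbit b₁ ε') with h2 | h2
      · rw [h1, h2]; exact pendPair_mono_left (hpath.h_anti hle)
      · rw [h1, h2] at hs; exact absurd (Bool.le_iff_imp.1 hs rfl) (by decide)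
      · rw [h1, h2]; simp only [Bool.false_eq_true, if_false, if_true]
        have := pendPair_le_swap (c := p j) (q₂ := (hullPair ends₂ c (p j)).swap) (hpath.h_anti hle) ?_ ?_
        · rwa [Prod.swap_swap] at this
        · rw [mem_hullPair_last_fst hp]
          intro hS
          have := (hfacts ε' true).2 hS
          rw [h2] at this; exact absurd this (by decide)
        · rw [mem_hullPair_last_snd hp]
          intro hS
          have := (hfacts ε false).2 hS
          rw [h1] at this; exact absurd this (by decide)
      · rw [h1, h2]; simp only [Bool.false_eq_true, if_false]
        exact pendPair_mono_left (hpath.h_anti hle)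
    · intro ε
      rw [pendPt_cubeNot_merged j (b₁, c) hm, hullPair_blue]
  · -- AFTER the key: the pendant never meets the hull of `l`; the block mirrors `l`
    have hnm : ¬ mergedAt j b₁ := fun hm => by have := hkv.1 hm; omega
    have hPl : ∀ ε, hullPair (Glue.glue (pathEnds p) ends₂) (pendPt j (b₁, c) ε) (p 0) =
        hullPair (pathEnds p) (pathPt b₁ ε) (p 0) := by
      intro ε
      rw [hullPair_pendPt_l j hg hl]
      refine pendPair_eq_of_notMem ?_ ?_
      · rw [mem_hullPair_zero_fst hp]; exact hafter hgt ε true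
      · rw [mem_hullPair_zero_snd hp]; exact hafter hgt ε false
    have hPh : ∀ ε, hullPair (Glue.glue (pathEnds p) ends₂) (pendPt j (b₁, c) ε)
        (p (Fin.last (k + 2))) =
        pendPair (hullPair (pathEnds p) (pathPt b₁ ε) (p (Fin.last (k + 2)))) (p j)
          (hullPair ends₂ c (p j)) := by
      intro ε
      rw [hullPair_pendPt_h j hg hh]
      simp [hnm]
    refine ⟨hinj, hmem, ?_, ?_, Or.inl ?_⟩
    · intro ε ε' hle
      rw [hPl, hPl]
      exact hpath.l_mono hle
    · intro ε ε' hle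
      rw [hPh, hPh]
      exact pendPair_mono_left (hpath.h_anti hle)
    · intro ε
      rw [hPl, hPl, pathPt_cubeNot, hullPair_blue]

/-- **The cube cover of a path with a pendant graph at an inner vertex.** -/
theorem cubeCover_path_pendant (hp : Function.Injective p) (j : Fin (k + 3))
    (hg : IsGluing (pathEnds p) ends₂ (p j) V₁ V₂) (hl : p 0 ∈ V₁) (hh : p (Fin.last (k + 2)) ∈ V₁)
    (hjl : j ≠ Fin.last (k + 2)) :
    CubeCover (Glue.glue (pathEnds p) ends₂) (p 0) (p (Fin.last (k + 2)))
      (pendPt (k := k) (E₂ := E₂) j) := by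
  refine ⟨fun b => cubeBlock_pend hp j hg hl hh hjl b, ?_, ?_⟩
  · intro ζ hζ
    rw [notMem_hull_glue_iff hg hl hh (fun h => hjl (hp h).symm)] at hζ
    obtain ⟨b, ε, he⟩ := (cubeCover_path hp).cover _ hζ
    refine ⟨(b, if mergedAt j b ∧ sbit b ε = true then blue (ζ ∘ Sum.inr) else ζ ∘ Sum.inr), ε, ?_⟩
    have key : pendPt j (b, if mergedAt j b ∧ sbit b ε = true then blue (ζ ∘ Sum.inr)
        else ζ ∘ Sum.inr) ε = pair (pathPt b ε) (ζ ∘ Sum.inr) := by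
      simp only [pendPt]
      congr 1
      split_ifs <;> simp [blue_blue]
    rw [key, he, pair_comp]
  · intro b b' ε ε' heq
    have h1 := congrArg (fun ζ => ζ ∘ Sum.inl) heq
    have h2 := congrArg (fun ζ => ζ ∘ Sum.inr) heq
    simp only [pendPt_inl] at h1
    have hb := (cubeCover_path hp).disj _ _ _ _ h1
    rcases b with ⟨b₁, c⟩
    rcases b' with ⟨b₁', c'⟩
    simp only at hb
    subst hb
    have hε : ε = ε' := by
      rcases Nat.lt_trichotomy 0 1 with _ | _ | _ <;>
      exact (by
        have hblock : CubeBlock (pathEnds p) (p 0) (p (Fin.last (k + 2))) (pathPt b₁) := by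
          cases b₁ with
          | inl i => exact cubeBlock_keyWord hp i
          | inr u => exact cubeBlock_sentWord hp
        exact hblock.inj h1)
    subst hε
    simp only [pendPt_inr] at h2
    congr 1
    split_ifs at h2 with hc
    · have := congrArg blue h2
      rwa [blue_blue, blue_blue] at this
    · exact h2

end Blocks

end Summit.Ventures.PercRepro2
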